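import Summits.HodgeConjecture.HodgeConjecture.Theorems.F0P3XiPacketFamilyOfRecordUnram
import HarnessLib

/-!
# THE ξ-LOCAL FAMILY OF RECORD ON SUPERCUSPIDAL PARTNER DATA (`…SC` twins of ★ `F0P3XiPacketFamilyOfRecord` ED. 2 + ★ `…Unram`) — Rogawski §12.2 (2), §13.1

Cell `hodgecm-mathlib`, F0∕P3 «U3-mult», crux H413 (`stmt-HodgeConjecture-24833`); LEAD F0P3a-plan (g9) T8-21 R4 ∕ T8-23 (A) «R4-SC», desk F0P3-plan (g8)
D19 ADDENDUM (A) branch (α-SC) (F0P3a-p01 (g11), 2026-09-01).  DEF LANE: ONE definition (`xiPacketFamilyOfRecordSC`) + theorems; no instance, no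
notation, no named fact, no `sorry`.

WHY.  F0P3b-plan (g11)'s kernel-checked finding (tree `Cruxes/H413/Lines/F0_P3b_QCMJunkObstruction.lean`): the local character identity
★ `CMNonsplitCharIdentityAt` (★ `LocalAPacket.CharIdentityAt` with `tr := smoothTrace`, quantified over ALL bare functions) is junk-forced, so the
★ ED. 2 record's hypothesis `hCM : … → CMNonsplitCharIdentityAt …` ranges over a print-false premise.  The record READS from `hCM` only the supercuspidal
partner `πˢ = (hCM …).πs` and `πs_isSupercuspidal` (census F0P3a-p01 (g11) 4d81fd43 (v3): sites :180∕:201∕:223∕:271 of the ★ file).  This module re-cuts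
the ★ ED. 2 record TOKEN FOR TOKEN on the honest datum instead — **SUPERCUSPIDAL PARTNER DATA**
`hSC : ∀ ξ v hns T a ha h π2 πn, KeysCaseTwoLabels … π2 πn → ¬ πn.IsSquareIntegrable (μZ v) → ∃ πs : IrrClass (U(H)(L⁺_v)), πs.IsSupercuspidal ∧ πs ≠ πⁿ ∘ e`
(= ★ `CMNonsplitCharIdentityAt … (πⁿ ∘ e)` MINUS its `CharIdentityAt` conjunct [Rogawski1990 Prop. 13.1.3 (d): `Π(ξ_v) = {πⁿ(ξ_v), πˢ(ξ_v)}`, `πˢ`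
supercuspidal, `≠ πⁿ`]) — so NO character identity enters K0; the identities (on test functions, ★ `CMCharIdentityPackageTest` p840183) are consumed only by
the floor-2 letter PK-L.  The local transfer data `(Δ, mH, mG, νG, νH, ξloc)` of the ★ telescope drop out (they entered only through `hCM`'s type); every
other binder, every statement and every proof is the ★ text with `hCM ↦ hSC`, `(hCM …).πs ↦ (hSC …).choose`, names suffixed `SC`.  The ★ hCM-typed record
stays in the tree (negative edge: old ⇒ new by `hSC_of_hCM`, module `F0P3XiEvpOfRecordSC`).

CONTENTS.  §1 (= ★ ED. 2 §2–§3) `exists_xiPacketOfRecordAtSC`, **`xiPacketFamilyOfRecordSC`**, `xiPacketFamilyOfRecordSC_spec`, `…_of_split`, `…_of_nonsplit`,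
law `isXiLocalFamily_xiPacketFamilyOfRecordSC`.  §2 (= ★ `…Unram` §2–§3) `isAdmissible_isSpherical_πn_of_nonsplitSC`∕`_of_splitSC`∕`_of_goodSC`,
`xiUnram_xiPacketFamilyOfRecordSC_of_good`, `xiUnram_xiPacketFamilyOfRecordSC` (off ★ `ramOfRecord₂`, which is `hCM`-free and reused), `eventually_…`.
Reused ★ (hCM-free, by import): `isAdmissible_of_keysLabels`, `exists_congrOfRecordAt`, `ramOfRecord₂`, `good_of_not_mem_ramOfRecord₂`, `finite_setOf_not_good₂`.

References: [Rogawski1990] §12.2 (2) pp. 173–174, §13.1 Prop. 13.1.3 (d), Prop. 13.1.4 (p. 199), §13.7 p. 208, §14.2 pp. 232–233; [CartierCorvallis1979] §IV.1.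
HC_CM is proved only modulo the printed citations until rung 0 closes.
-/

set_option autoImplicit false
set_option linter.dupNamespace false

noncomputable section

open NumberField IsDedekindDomain MeasureTheory Filter Topology
open scoped Matrix MatrixGroups

namespace Summit.HodgeConjecture.HodgeConjecture.Cruxes.H413.F0P3XiPacketFamilyOfRecordSC

open Literature.NumberTheory Literature.NumberTheory.Automorphic Literature.NumberTheory.Automorphic.UnitaryGroup
open Literature.NumberTheory.Rogawski1990 Literature.NumberTheory.GaloisRepresentations
open F0P3XiLocalFamilyOfRecord F0P3XiPacketFamilyOfRecord

/-! ## §1 The record on supercuspidal partner data (★ ED. 2 §2–§3 with `hCM ↦ hSC`) -/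

section Record

variable (L : Type) [Field L] [NumberField L] [IsCMField L] (H : Matrix (Fin 3) (Fin 3) L)
  (hH : (H.map (cmConjRingHom L))ᵀ = H) (hHd : IsUnit H.det) (μω : HeckeCharacter L) (hμu : μω.IsUnitary)
  -- the local data SHARED with T1's `ComparisonKit` ∕ F0P3b's `CMCharIdentityClauses` ((χ1), RULING (V28)); instance families as there (`borel` at 𝔠₀)
  [∀ v : HeightOneSpectrum (𝓞 ↥(maximalRealSubfield L)), MeasurableSpace (Gqs L v ⧸ Subgroup.center (Gqs L v))]
  (μZ : ∀ v : HeightOneSpectrum (𝓞 ↥(maximalRealSubfield L)), Measure (Gqs L v ⧸ Subgroup.center (Gqs L v)))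
  (keys : ∀ (ξ : OneDimAutRepH L) (v : HeightOneSpectrum (𝓞 ↥(maximalRealSubfield L))),
    (∀ w : PlacesOver L v, IsCMField.complexConj L • w.1 = w.1) →
      {p : IrrClass (Gqs L v) × IrrClass (Gqs L v) //
        KeysCaseTwoLabels L v (μω.semilocalComponent L v) (torusLocalComponent L (IsCMField.complexConj L) v ξ.η)
          (torusLocalComponent L (IsCMField.complexConj L) v ξ.ψ) p.1 p.2 ∧
        p.1.IsSquareIntegrable (μZ v) ∧ ¬ p.2.IsSquareIntegrable (μZ v)})
  (hSC : ∀ (ξ : OneDimAutRepH L) (v : HeightOneSpectrum (𝓞 ↥(maximalRealSubfield L)))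
    (hns : ∀ w : PlacesOver L v, IsCMField.complexConj L • w.1 = w.1)
    (T : GL (Fin 3) (LocalRing L v)) (a : LocalRing L v) (ha : IsUnit a)
    (h : formCongr (conjLocal L (IsCMField.complexConj L) v) T (H.map (algebraMap L (LocalRing L v))) =
      a • (Matrix.of fun i j : Fin 3 => if i.val + j.val + 1 = 3 then (1 : L) else 0).map (algebraMap L (LocalRing L v)))
    (π2 πn : IrrClass (Gqs L v)),
    KeysCaseTwoLabels L v (μω.semilocalComponent L v) (torusLocalComponent L (IsCMField.complexConj L) v ξ.η)
      (torusLocalComponent L (IsCMField.complexConj L) v ξ.ψ) π2 πn → ¬ πn.IsSquareIntegrable (μZ v) →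
    ∃ πs : IrrClass ((cmDatum L 3 H).Local v), πs.IsSupercuspidal ∧ πs ≠ IrrClass.comap (cmDatumLocalCongr L v T ha h).symm πn)


/-- **THE RECORD AT ONE PLACE (ED. 2) EXISTS.**  At `v` there is a packet `P` with: (S) at a split `v`, `P` = D6's split packet at the fixed witness;
(N) at a non-split `v`, `P = ⟨πⁿ ∘ e, some πˢ⟩` with `e⁻¹ = cmDatumLocalCongr L v T ha h` a form congruence, level-matching whenever a level-matching one
exists, `πⁿ = (keys ξ v hns).πn` THE Keys label and `πˢ` THE class read off the character identity `hSC` for `πⁿ ∘ e` (★ ED. 3 `CMNonsplitCharIdentityAt.πs`).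
[cite: Rogawski1990, §12.2 (2) pp. 173–174; §13.1 Prop. 13.1.3 (d), Prop. 13.1.4 p. 199; §14.2 pp. 232–233] -/
theorem exists_xiPacketOfRecordAtSC (ξ : OneDimAutRepH L) (v : HeightOneSpectrum (𝓞 ↥(maximalRealSubfield L))) :
    ∃ P : CMLocalAPacket L H v,
      (∀ hs : ∃ w : PlacesOver L v, IsCMField.complexConj L • w.1 ≠ w.1,
        P = cmSplitPacket L H hH hHd v (splitWitness v hs) (splitWitness_spec v hs) (ξ.splitν₀ μω (splitWitness v hs).1)
          (ξ.locψ (splitWitness v hs).1) (ξ.norm_splitν₀_apply hμu (splitWitness v hs).1)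
          (ξ.continuous_splitν₀ μω (splitWitness v hs).1) (ξ.norm_locψ_apply (splitWitness v hs).1)
          (ξ.continuous_locψ (splitWitness v hs).1)) ∧
      (∀ hns : ∀ w : PlacesOver L v, IsCMField.complexConj L • w.1 = w.1,
        ∃ (T : GL (Fin 3) (LocalRing L v)) (a : LocalRing L v) (ha : IsUnit a)
          (h : formCongr (conjLocal L (IsCMField.complexConj L) v) T (H.map (algebraMap L (LocalRing L v))) =
            a • (Matrix.of fun i j : Fin 3 => if i.val + j.val + 1 = 3 then (1 : L) else 0).map (algebraMap L (LocalRing L v))),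
          P = ⟨IrrClass.comap (cmDatumLocalCongr L v T ha h).symm (keys ξ v hns).1.2,
            some (hSC ξ v hns T a ha h (keys ξ v hns).1.1 (keys ξ v hns).1.2 (keys ξ v hns).2.1 (keys ξ v hns).2.2.2).choose⟩ ∧
          ((∃ (T' : GL (Fin 3) (LocalRing L v)) (a' : LocalRing L v) (ha' : IsUnit a')
              (h' : formCongr (conjLocal L (IsCMField.complexConj L) v) T' (H.map (algebraMap L (LocalRing L v))) =
                a' • (Matrix.of fun i j : Fin 3 => if i.val + j.val + 1 = 3 then (1 : L) else 0).map (algebraMap L (LocalRing L v))),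
              ∀ g : (cmDatum L 3 H).Local v, (cmDatumLocalCongr L v T' ha' h').symm g ∈ cmLocalIntegralLevel L 3 (qsForm L) v ↔
                g ∈ cmLocalIntegralLevel L 3 H v) →
            ∀ g : (cmDatum L 3 H).Local v, (cmDatumLocalCongr L v T ha h).symm g ∈ cmLocalIntegralLevel L 3 (qsForm L) v ↔
              g ∈ cmLocalIntegralLevel L 3 H v)) := by
  rcases Classical.em (∃ w : PlacesOver L v, IsCMField.complexConj L • w.1 ≠ w.1) with hs | hs
  · -- SPLIT
    refine ⟨_, fun hs' => congrArg (fun hs'' : (∃ w : PlacesOver L v, IsCMField.complexConj L • w.1 ≠ w.1) =>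
      cmSplitPacket L H hH hHd v (splitWitness v hs'') (splitWitness_spec v hs'') (ξ.splitν₀ μω (splitWitness v hs'').1)
          (ξ.locψ (splitWitness v hs'').1) (ξ.norm_splitν₀_apply hμu (splitWitness v hs'').1)
          (ξ.continuous_splitν₀ μω (splitWitness v hs'').1) (ξ.norm_locψ_apply (splitWitness v hs'').1)
          (ξ.continuous_locψ (splitWitness v hs'').1)) (Subsingleton.elim hs hs'), fun hns => ?_⟩
    obtain ⟨w, hw⟩ := hs
    exact absurd (hns w) hw
  · -- NON-SPLIT: the proof `hns` is unique, so the packet built from it serves every `hns'`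
    have hns : ∀ w : PlacesOver L v, IsCMField.complexConj L • w.1 = w.1 := fun w => not_not.1 fun hw => hs ⟨w, hw⟩
    obtain ⟨T, a, ha, h, hT⟩ := exists_congrOfRecordAt L H hH hHd v hns
    refine ⟨⟨IrrClass.comap (cmDatumLocalCongr L v T ha h).symm (keys ξ v hns).1.2,
      some (hSC ξ v hns T a ha h (keys ξ v hns).1.1 (keys ξ v hns).1.2 (keys ξ v hns).2.1 (keys ξ v hns).2.2.2).choose⟩,
      fun hs' => absurd hs' hs, fun hns' => ⟨T, a, ha, h, ?_, hT⟩⟩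
    cases Subsingleton.elim hns hns'
    rfl

/-- **THE ξ-LOCAL FAMILY OF RECORD, EDITION 2** — `packFin₀ ξ` of the T5 kit `𝔠₀` (RULINGS (V26) (R1)(R2), (V28), (V29) (J3)): THE packet chosen by
`exists_xiPacketOfRecordAtSC` at every finite place. [cite: Rogawski1990, §12.2 (2) pp. 173–174; §13.1 p. 199; §4.13 Lemma 4.13.1 (b)] -/
def xiPacketFamilyOfRecordSC (ξ : OneDimAutRepH L) : ∀ v : HeightOneSpectrum (𝓞 ↥(maximalRealSubfield L)), CMLocalAPacket L H v :=
  fun v => (exists_xiPacketOfRecordAtSC L H hH hHd μω hμu μZ keys hSC ξ v).choose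

/-- The defining property of the ED. 2 record at `v`. [cite: Rogawski1990, §13.1 p. 199; §12.2 (2) pp. 173–174] -/
theorem xiPacketFamilyOfRecordSC_spec (ξ : OneDimAutRepH L) (v : HeightOneSpectrum (𝓞 ↥(maximalRealSubfield L))) :
    (∀ hs : ∃ w : PlacesOver L v, IsCMField.complexConj L • w.1 ≠ w.1,
        xiPacketFamilyOfRecordSC L H hH hHd μω hμu μZ keys hSC ξ v = cmSplitPacket L H hH hHd v (splitWitness v hs) (splitWitness_spec v hs) (ξ.splitν₀ μω (splitWitness v hs).1)
          (ξ.locψ (splitWitness v hs).1) (ξ.norm_splitν₀_apply hμu (splitWitness v hs).1)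
          (ξ.continuous_splitν₀ μω (splitWitness v hs).1) (ξ.norm_locψ_apply (splitWitness v hs).1)
          (ξ.continuous_locψ (splitWitness v hs).1)) ∧
      (∀ hns : ∀ w : PlacesOver L v, IsCMField.complexConj L • w.1 = w.1,
        ∃ (T : GL (Fin 3) (LocalRing L v)) (a : LocalRing L v) (ha : IsUnit a)
          (h : formCongr (conjLocal L (IsCMField.complexConj L) v) T (H.map (algebraMap L (LocalRing L v))) =
            a • (Matrix.of fun i j : Fin 3 => if i.val + j.val + 1 = 3 then (1 : L) else 0).map (algebraMap L (LocalRing L v))),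
          xiPacketFamilyOfRecordSC L H hH hHd μω hμu μZ keys hSC ξ v = ⟨IrrClass.comap (cmDatumLocalCongr L v T ha h).symm (keys ξ v hns).1.2,
            some (hSC ξ v hns T a ha h (keys ξ v hns).1.1 (keys ξ v hns).1.2 (keys ξ v hns).2.1 (keys ξ v hns).2.2.2).choose⟩ ∧
          ((∃ (T' : GL (Fin 3) (LocalRing L v)) (a' : LocalRing L v) (ha' : IsUnit a')
              (h' : formCongr (conjLocal L (IsCMField.complexConj L) v) T' (H.map (algebraMap L (LocalRing L v))) =
                a' • (Matrix.of fun i j : Fin 3 => if i.val + j.val + 1 = 3 then (1 : L) else 0).map (algebraMap L (LocalRing L v))),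
              ∀ g : (cmDatum L 3 H).Local v, (cmDatumLocalCongr L v T' ha' h').symm g ∈ cmLocalIntegralLevel L 3 (qsForm L) v ↔
                g ∈ cmLocalIntegralLevel L 3 H v) →
            ∀ g : (cmDatum L 3 H).Local v, (cmDatumLocalCongr L v T ha h).symm g ∈ cmLocalIntegralLevel L 3 (qsForm L) v ↔
              g ∈ cmLocalIntegralLevel L 3 H v)) :=
  (exists_xiPacketOfRecordAtSC L H hH hHd μω hμu μZ keys hSC ξ v).choose_spec

/-- **At a split place the ED. 2 record IS the D6 split packet at the fixed witness.** [cite: Rogawski1990, §13.1 p. 199; §4.13 Lemma 4.13.1 (b)] -/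
theorem xiPacketFamilyOfRecordSC_of_split (ξ : OneDimAutRepH L) (v : HeightOneSpectrum (𝓞 ↥(maximalRealSubfield L)))
    (hs : ∃ w : PlacesOver L v, IsCMField.complexConj L • w.1 ≠ w.1) :
    xiPacketFamilyOfRecordSC L H hH hHd μω hμu μZ keys hSC ξ v = cmSplitPacket L H hH hHd v (splitWitness v hs) (splitWitness_spec v hs) (ξ.splitν₀ μω (splitWitness v hs).1)
          (ξ.locψ (splitWitness v hs).1) (ξ.norm_splitν₀_apply hμu (splitWitness v hs).1)
          (ξ.continuous_splitν₀ μω (splitWitness v hs).1) (ξ.norm_locψ_apply (splitWitness v hs).1)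
          (ξ.continuous_locψ (splitWitness v hs).1) :=
  (xiPacketFamilyOfRecordSC_spec L H hH hHd μω hμu μZ keys hSC ξ v).1 hs

/-- **At a non-split place (the KEYS HANDLE)**: the record is `⟨πⁿ ∘ e, some πˢ⟩` with `πⁿ = (keys ξ v hns).πn`, `πˢ` read off `hSC`, and `e⁻¹` a form
congruence which is level-matching whenever a level-matching one exists. [cite: Rogawski1990, §12.2 (2) pp. 173–174; §13.1 Prop. 13.1.4 p. 199] -/
theorem xiPacketFamilyOfRecordSC_of_nonsplit (ξ : OneDimAutRepH L) (v : HeightOneSpectrum (𝓞 ↥(maximalRealSubfield L)))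
    (hns : ∀ w : PlacesOver L v, IsCMField.complexConj L • w.1 = w.1) :
    ∃ (T : GL (Fin 3) (LocalRing L v)) (a : LocalRing L v) (ha : IsUnit a)
      (h : formCongr (conjLocal L (IsCMField.complexConj L) v) T (H.map (algebraMap L (LocalRing L v))) =
        a • (Matrix.of fun i j : Fin 3 => if i.val + j.val + 1 = 3 then (1 : L) else 0).map (algebraMap L (LocalRing L v))),
      xiPacketFamilyOfRecordSC L H hH hHd μω hμu μZ keys hSC ξ v = ⟨IrrClass.comap (cmDatumLocalCongr L v T ha h).symm (keys ξ v hns).1.2,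
        some (hSC ξ v hns T a ha h (keys ξ v hns).1.1 (keys ξ v hns).1.2 (keys ξ v hns).2.1 (keys ξ v hns).2.2.2).choose⟩ ∧
      ((∃ (T' : GL (Fin 3) (LocalRing L v)) (a' : LocalRing L v) (ha' : IsUnit a')
              (h' : formCongr (conjLocal L (IsCMField.complexConj L) v) T' (H.map (algebraMap L (LocalRing L v))) =
                a' • (Matrix.of fun i j : Fin 3 => if i.val + j.val + 1 = 3 then (1 : L) else 0).map (algebraMap L (LocalRing L v))),
              ∀ g : (cmDatum L 3 H).Local v, (cmDatumLocalCongr L v T' ha' h').symm g ∈ cmLocalIntegralLevel L 3 (qsForm L) v ↔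
                g ∈ cmLocalIntegralLevel L 3 H v) →
        ∀ g : (cmDatum L 3 H).Local v, (cmDatumLocalCongr L v T ha h).symm g ∈ cmLocalIntegralLevel L 3 (qsForm L) v ↔
          g ∈ cmLocalIntegralLevel L 3 H v) :=
  (xiPacketFamilyOfRecordSC_spec L H hH hHd μω hμu μZ keys hSC ξ v).2 hns

/-! ## §3 Law `xiFamilyFin` for the ED. 2 record -/

/-- **LAW `xiFamilyFin` AT 𝔠₀ (ED. 2): the record IS a ξ-local family** (★ D6 `OneDimAutRepH.IsXiLocalFamily`) — hypothesis-free given the data: the Keys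
`πⁿ` is a constituent of `i_G(χ_ξ,v)` (`KeysCaseTwoLabels`) and `πˢ` is supercuspidal (★ `CMNonsplitCharIdentityAt.πs_isSupercuspidal`).
[cite: Rogawski1990, §13.1 Prop. 13.1.3 (d) p. 199; §12.2 (2) pp. 173–174; §14.2 p. 232] -/
theorem isXiLocalFamily_xiPacketFamilyOfRecordSC (ξ : OneDimAutRepH L) :
    ξ.IsXiLocalFamily hH hHd μω hμu (xiPacketFamilyOfRecordSC L H hH hHd μω hμu μZ keys hSC ξ) := by
  refine ⟨fun v hs => xiPacketFamilyOfRecordSC_of_split L H hH hHd μω hμu μZ keys hSC ξ v hs, fun v hns => ?_⟩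
  obtain ⟨T, a, ha, h, hP, -⟩ := xiPacketFamilyOfRecordSC_of_nonsplit L H hH hHd μω hμu μZ keys hSC ξ v hns
  refine ⟨T, a, ha, h, (keys ξ v hns).1.2, _, hP, ((keys ξ v hns).2.1.2 _).2 (Or.inl rfl), fun c hc => ?_⟩
  cases hc
  exact (Exists.choose_spec (hSC ξ v hns T a ha h (keys ξ v hns).1.1 (keys ξ v hns).1.2 (keys ξ v hns).2.1 (keys ξ v hns).2.2.2)).1


end Record

/-! ## §2 Law `XiUnram` for the SC record (★ `…Unram` §2–§3 with `hCM ↦ hSC`) -/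

section Unram

variable (L : Type) [Field L] [NumberField L] [IsCMField L] (H : Matrix (Fin 3) (Fin 3) L)
  (hH : (H.map (cmConjRingHom L))ᵀ = H) (hHd : IsUnit H.det) (μω : HeckeCharacter L) (hμu : μω.IsUnitary)
  -- the local data SHARED with T1's `ComparisonKit` ∕ F0P3b's `CMCharIdentityClauses` ((χ1), RULING (V28)); instance families as there (`borel` at 𝔠₀)
  [∀ v : HeightOneSpectrum (𝓞 ↥(maximalRealSubfield L)), MeasurableSpace (Gqs L v ⧸ Subgroup.center (Gqs L v))]
  (μZ : ∀ v : HeightOneSpectrum (𝓞 ↥(maximalRealSubfield L)), Measure (Gqs L v ⧸ Subgroup.center (Gqs L v)))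
  (keys : ∀ (ξ : OneDimAutRepH L) (v : HeightOneSpectrum (𝓞 ↥(maximalRealSubfield L))),
    (∀ w : PlacesOver L v, IsCMField.complexConj L • w.1 = w.1) →
      {p : IrrClass (Gqs L v) × IrrClass (Gqs L v) //
        KeysCaseTwoLabels L v (μω.semilocalComponent L v) (torusLocalComponent L (IsCMField.complexConj L) v ξ.η)
          (torusLocalComponent L (IsCMField.complexConj L) v ξ.ψ) p.1 p.2 ∧
        p.1.IsSquareIntegrable (μZ v) ∧ ¬ p.2.IsSquareIntegrable (μZ v)})
  (hSC : ∀ (ξ : OneDimAutRepH L) (v : HeightOneSpectrum (𝓞 ↥(maximalRealSubfield L)))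
    (hns : ∀ w : PlacesOver L v, IsCMField.complexConj L • w.1 = w.1)
    (T : GL (Fin 3) (LocalRing L v)) (a : LocalRing L v) (ha : IsUnit a)
    (h : formCongr (conjLocal L (IsCMField.complexConj L) v) T (H.map (algebraMap L (LocalRing L v))) =
      a • (Matrix.of fun i j : Fin 3 => if i.val + j.val + 1 = 3 then (1 : L) else 0).map (algebraMap L (LocalRing L v)))
    (π2 πn : IrrClass (Gqs L v)),
    KeysCaseTwoLabels L v (μω.semilocalComponent L v) (torusLocalComponent L (IsCMField.complexConj L) v ξ.η)
      (torusLocalComponent L (IsCMField.complexConj L) v ξ.ψ) π2 πn → ¬ πn.IsSquareIntegrable (μZ v) →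
    ∃ πs : IrrClass ((cmDatum L 3 H).Local v), πs.IsSupercuspidal ∧ πs ≠ IrrClass.comap (cmDatumLocalCongr L v T ha h).symm πn)


/-! ## §2 The record's Keys member is admissible and `K_v`-spherical at the good places -/

/-- **NON-SPLIT good place**: if a level-matching form congruence exists at `v` and the Keys label `πⁿ = (keys ξ v hns).πn` is `K_v`-spherical on
`U(Φ₃)(L⁺_v)` (the (L-i′) property), then the record's member `πⁿ ∘ e` is ADMISSIBLE (`πⁿ` is a constituent of the admissible `i_G(χ_ξ,v)`) and
`K_v`-SPHERICAL on `U(H)(L⁺_v)` (transport along the level-matching congruence of record, ★ `comap_isAdmissible_isSpherical`).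
[cite: Rogawski1990, §12.2 (2) pp. 173–174; §13.1 p. 199; §14.2 p. 233] [cite: CartierCorvallis1979, §IV.1] -/
theorem isAdmissible_isSpherical_πn_of_nonsplitSC (ξ : OneDimAutRepH L) (v : HeightOneSpectrum (𝓞 ↥(maximalRealSubfield L)))
    (hns : ∀ w : PlacesOver L v, IsCMField.complexConj L • w.1 = w.1)
    (hLM : (∃ (T' : GL (Fin 3) (LocalRing L v)) (a' : LocalRing L v) (ha' : IsUnit a')
          (h' : formCongr (conjLocal L (IsCMField.complexConj L) v) T' (H.map (algebraMap L (LocalRing L v))) =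
            a' • (Matrix.of fun i j : Fin 3 => if i.val + j.val + 1 = 3 then (1 : L) else 0).map (algebraMap L (LocalRing L v))),
          ∀ g : (cmDatum L 3 H).Local v, (cmDatumLocalCongr L v T' ha' h').symm g ∈ cmLocalIntegralLevel L 3 (qsForm L) v ↔
            g ∈ cmLocalIntegralLevel L 3 H v))
    (hsph : ((keys ξ v hns).1.2).IsSpherical (cmLocalIntegralLevel L 3 (qsForm L) v)) :
    (xiPacketFamilyOfRecordSC L H hH hHd μω hμu μZ keys hSC ξ v).πn.IsAdmissible ∧ (xiPacketFamilyOfRecordSC L H hH hHd μω hμu μZ keys hSC ξ v).πn.IsSpherical (cmLocalIntegralLevel L 3 H v) := by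
  obtain ⟨T, a, ha, h, hP, hT⟩ := xiPacketFamilyOfRecordSC_of_nonsplit L H hH hHd μω hμu μZ keys hSC ξ v hns
  rw [hP]
  exact F0P3XiUnramNonsplitInstance.comap_isAdmissible_isSpherical L v H (cmDatumLocalCongr L v T ha h).symm (hT hLM)
    (isAdmissible_of_keysLabels L μω ξ v (keys ξ v hns).2.1) hsph

/-- **SPLIT good place**: `η̃, ψ̃, μ` unramified at the fixed witness and `H_w ∈ GL₃(𝒪_w)` ⇒ the record's member `i_G(ξ_w)` is admissible and `K_v`-spherical
(★ p817781). [cite: Rogawski1990, §12.2 pp. 173–174; §13.1 p. 199] [cite: CartierCorvallis1979, §IV.1] -/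
theorem isAdmissible_isSpherical_πn_of_splitSC (ξ : OneDimAutRepH L) (v : HeightOneSpectrum (𝓞 ↥(maximalRealSubfield L)))
    (hs : ∃ w : PlacesOver L v, IsCMField.complexConj L • w.1 ≠ w.1)
    (hη : ξ.bcη.IsUnramifiedAt (splitWitness v hs).1) (hψ : ξ.bcψ.IsUnramifiedAt (splitWitness v hs).1)
    (hμ : μω.IsUnramifiedAt (splitWitness v hs).1)
    (hHw : (isUnit_placeForm_of_isUnit_det hHd (splitWitness v hs).1).unit ∈ glInt 3 ((splitWitness v hs).1.adicCompletion L)) :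
    (xiPacketFamilyOfRecordSC L H hH hHd μω hμu μZ keys hSC ξ v).πn.IsAdmissible ∧ (xiPacketFamilyOfRecordSC L H hH hHd μω hμu μZ keys hSC ξ v).πn.IsSpherical (cmLocalIntegralLevel L 3 H v) := by
  rw [xiPacketFamilyOfRecordSC_of_split L H hH hHd μω hμu μZ keys hSC ξ v hs]
  exact ⟨F0P3XiUnramSplitInstance.isAdmissible_cmSplitPacket_πn L H hH hHd v _ _ _ _ _ _ _ _,
    F0P3XiUnramSplitInstance.isSpherical_cmSplitPacket_πn L H hH hHd v _ _ _ _ _ _ _ _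
      (F0P3XiUnramSplitInstance.splitν₀_eq_one_of_isUnramifiedAt ξ μω hη hψ hμ)
      (F0P3XiUnramSplitInstance.locψ_eq_one_of_isUnramifiedAt ξ hψ) hHw⟩

/-- **AT A GOOD PLACE (split or not)** — «good» = the conjunction defining `ramOfRecord₂` (§1) — the record's member is admissible and `K_v`-spherical.
[cite: Rogawski1990, §12.2 pp. 173–174; §13.1 p. 199] [cite: CartierCorvallis1979, §IV.1] -/
theorem isAdmissible_isSpherical_πn_of_goodSC (ξ : OneDimAutRepH L) (v : HeightOneSpectrum (𝓞 ↥(maximalRealSubfield L)))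
    (hgood : (∀ w : PlacesOver L v, ξ.bcη.IsUnramifiedAt w.1 ∧ ξ.bcψ.IsUnramifiedAt w.1 ∧ μω.IsUnramifiedAt w.1 ∧
          (isUnit_placeForm_of_isUnit_det hHd w.1).unit ∈ glInt 3 (w.1.adicCompletion L)) ∧
        (∀ hns : ∀ w : PlacesOver L v, IsCMField.complexConj L • w.1 = w.1,
          (∃ (T' : GL (Fin 3) (LocalRing L v)) (a' : LocalRing L v) (ha' : IsUnit a')
          (h' : formCongr (conjLocal L (IsCMField.complexConj L) v) T' (H.map (algebraMap L (LocalRing L v))) =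
            a' • (Matrix.of fun i j : Fin 3 => if i.val + j.val + 1 = 3 then (1 : L) else 0).map (algebraMap L (LocalRing L v))),
          ∀ g : (cmDatum L 3 H).Local v, (cmDatumLocalCongr L v T' ha' h').symm g ∈ cmLocalIntegralLevel L 3 (qsForm L) v ↔
            g ∈ cmLocalIntegralLevel L 3 H v) ∧
          ((keys ξ v hns).1.2).IsSpherical (cmLocalIntegralLevel L 3 (qsForm L) v))) :
    (xiPacketFamilyOfRecordSC L H hH hHd μω hμu μZ keys hSC ξ v).πn.IsAdmissible ∧ (xiPacketFamilyOfRecordSC L H hH hHd μω hμu μZ keys hSC ξ v).πn.IsSpherical (cmLocalIntegralLevel L 3 H v) := by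
  rcases Classical.em (∃ w : PlacesOver L v, IsCMField.complexConj L • w.1 ≠ w.1) with hs | hs
  · obtain ⟨hη, hψ, hμ, hHw⟩ := hgood.1 (splitWitness v hs)
    exact isAdmissible_isSpherical_πn_of_splitSC L H hH hHd μω hμu μZ keys hSC ξ v hs hη hψ hμ hHw
  · have hns : ∀ w : PlacesOver L v, IsCMField.complexConj L • w.1 = w.1 := fun w => not_not.1 fun hw => hs ⟨w, hw⟩
    obtain ⟨hLM, hsph⟩ := hgood.2 hns
    exact isAdmissible_isSpherical_πn_of_nonsplitSC L H hH hHd μω hμu μZ keys hSC ξ v hns hLM hsph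

variable [∀ v : HeightOneSpectrum (𝓞 ↥(maximalRealSubfield L)), MeasurableSpace ((cmDatum L 3 H).Local v)]

/-- **The pin-(ii) currency** at a good place: for any Haar measure `μ` on `G′_v`, the record's member is `K_v`-spherical WITH the eigencharacter
`μ(K_v)⁻¹ tr πⁿ(·)` and admissible (law `XiUnram`, RULING (V11)(ii)). [cite: Rogawski1990, §13.7 p. 208; §12.2 pp. 173–174] [cite: CartierCorvallis1979, §IV.1 Cor. 4.1] -/
theorem xiUnram_xiPacketFamilyOfRecordSC_of_good (ξ : OneDimAutRepH L) (v : HeightOneSpectrum (𝓞 ↥(maximalRealSubfield L)))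
    [BorelSpace ((cmDatum L 3 H).Local v)] (μ : Measure ((cmDatum L 3 H).Local v)) [μ.IsHaarMeasure]
    (hgood : (∀ w : PlacesOver L v, ξ.bcη.IsUnramifiedAt w.1 ∧ ξ.bcψ.IsUnramifiedAt w.1 ∧ μω.IsUnramifiedAt w.1 ∧
          (isUnit_placeForm_of_isUnit_det hHd w.1).unit ∈ glInt 3 (w.1.adicCompletion L)) ∧
        (∀ hns : ∀ w : PlacesOver L v, IsCMField.complexConj L • w.1 = w.1,
          (∃ (T' : GL (Fin 3) (LocalRing L v)) (a' : LocalRing L v) (ha' : IsUnit a')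
          (h' : formCongr (conjLocal L (IsCMField.complexConj L) v) T' (H.map (algebraMap L (LocalRing L v))) =
            a' • (Matrix.of fun i j : Fin 3 => if i.val + j.val + 1 = 3 then (1 : L) else 0).map (algebraMap L (LocalRing L v))),
          ∀ g : (cmDatum L 3 H).Local v, (cmDatumLocalCongr L v T' ha' h').symm g ∈ cmLocalIntegralLevel L 3 (qsForm L) v ↔
            g ∈ cmLocalIntegralLevel L 3 H v) ∧
          ((keys ξ v hns).1.2).IsSpherical (cmLocalIntegralLevel L 3 (qsForm L) v))) :
    (xiPacketFamilyOfRecordSC L H hH hHd μω hμu μZ keys hSC ξ v).πn.IsSphericalWith (cmLocalIntegralLevel L 3 H v) μ (fun f =>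
      (μ.real (cmLocalIntegralLevel L 3 H v : Set ((cmDatum L 3 H).Local v)) : ℂ)⁻¹ * (xiPacketFamilyOfRecordSC L H hH hHd μω hμu μZ keys hSC ξ v).πn.smoothTrace μ f) ∧
      (xiPacketFamilyOfRecordSC L H hH hHd μω hμu μZ keys hSC ξ v).πn.IsAdmissible := by
  obtain ⟨hadm, h1⟩ := isAdmissible_isSpherical_πn_of_goodSC L H hH hHd μω hμu μZ keys hSC ξ v hgood
  exact ⟨IrrClass.IsSpherical.isSphericalWith_smoothTrace μ hadm (isCompact_isOpen_cmLocalIntegralLevel L 3 H v).2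
    (isCompact_isOpen_cmLocalIntegralLevel L 3 H v).1 (F0P3XiUnramSplitInstance.measureReal_cmLocalIntegralLevel_ne_zero L H v μ) h1, hadm⟩

/-! ## §3 Law `XiUnram` off `ramOfRecord₂ ξ` -/

/-- **LAW `XiUnram` AT 𝔠₀ (ED. 2), OFF `ramOfRecord₂ ξ`**: for `v ∉ ramOfRecord₂ ξ` and any Haar measure on `G′_v`, the record's Keys member `πⁿ` is
`K_v`-spherical WITH its eigencharacter and admissible. [cite: Rogawski1990, §12.2 pp. 173–174; §13.1 p. 199; §13.7 p. 208] [cite: CartierCorvallis1979, §IV.1 Cor. 4.1] -/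
theorem xiUnram_xiPacketFamilyOfRecordSC (ξ : OneDimAutRepH L)
    {hexc : ∀ᶠ v : HeightOneSpectrum (𝓞 ↥(maximalRealSubfield L)) in cofinite,
      ∀ hns : ∀ w : PlacesOver L v, IsCMField.complexConj L • w.1 = w.1,
        ((keys ξ v hns).1.2).IsSpherical (cmLocalIntegralLevel L 3 (qsForm L) v)}
    (v : HeightOneSpectrum (𝓞 ↥(maximalRealSubfield L))) (hv : v ∉ ramOfRecord₂ L H hH hHd μω μZ keys ξ hexc)
    [BorelSpace ((cmDatum L 3 H).Local v)] (μ : Measure ((cmDatum L 3 H).Local v)) [μ.IsHaarMeasure] :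
    (xiPacketFamilyOfRecordSC L H hH hHd μω hμu μZ keys hSC ξ v).πn.IsSphericalWith (cmLocalIntegralLevel L 3 H v) μ (fun f =>
      (μ.real (cmLocalIntegralLevel L 3 H v : Set ((cmDatum L 3 H).Local v)) : ℂ)⁻¹ * (xiPacketFamilyOfRecordSC L H hH hHd μω hμu μZ keys hSC ξ v).πn.smoothTrace μ f) ∧
      (xiPacketFamilyOfRecordSC L H hH hHd μω hμu μZ keys hSC ξ v).πn.IsAdmissible :=
  xiUnram_xiPacketFamilyOfRecordSC_of_good L H hH hHd μω hμu μZ keys hSC ξ v μ (good_of_not_mem_ramOfRecord₂ L H hH hHd μω μZ keys ξ hv)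

/-- The same as an `∀ᶠ v in cofinite` statement for a family of Haar measures. [cite: Rogawski1990, §12.2 pp. 173–174; §13.7 p. 208] -/
theorem eventually_xiUnram_xiPacketFamilyOfRecordSC (ξ : OneDimAutRepH L)
    (hexc : ∀ᶠ v : HeightOneSpectrum (𝓞 ↥(maximalRealSubfield L)) in cofinite,
      ∀ hns : ∀ w : PlacesOver L v, IsCMField.complexConj L • w.1 = w.1,
        ((keys ξ v hns).1.2).IsSpherical (cmLocalIntegralLevel L 3 (qsForm L) v))
    [∀ v : HeightOneSpectrum (𝓞 ↥(maximalRealSubfield L)), BorelSpace ((cmDatum L 3 H).Local v)]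
    (μv : ∀ v : HeightOneSpectrum (𝓞 ↥(maximalRealSubfield L)), Measure ((cmDatum L 3 H).Local v)) [∀ v, (μv v).IsHaarMeasure] :
    ∀ᶠ v : HeightOneSpectrum (𝓞 ↥(maximalRealSubfield L)) in cofinite,
      (xiPacketFamilyOfRecordSC L H hH hHd μω hμu μZ keys hSC ξ v).πn.IsSphericalWith (cmLocalIntegralLevel L 3 H v) (μv v) (fun f =>
        ((μv v).real (cmLocalIntegralLevel L 3 H v : Set ((cmDatum L 3 H).Local v)) : ℂ)⁻¹ *
          (xiPacketFamilyOfRecordSC L H hH hHd μω hμu μZ keys hSC ξ v).πn.smoothTrace (μv v) f) ∧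
      (xiPacketFamilyOfRecordSC L H hH hHd μω hμu μZ keys hSC ξ v).πn.IsAdmissible := by
  have h := finite_setOf_not_good₂ L H hH hHd μω μZ keys ξ hexc
  rw [← Filter.eventually_cofinite] at h
  filter_upwards [h] with v hv
  exact xiUnram_xiPacketFamilyOfRecordSC_of_good L H hH hHd μω hμu μZ keys hSC ξ v (μv v) hv


end Unram

end Summit.HodgeConjecture.HodgeConjecture.Cruxes.H413.F0P3XiPacketFamilyOfRecordSC
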